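import Mathlib.Topology.EMetricSpace.BoundedVariation
import Mathlib.MeasureTheory.Integral.IntervalIntegral.Basic
import Mathlib.Analysis.Calculus.Deriv.Basic
import Mathlib.Analysis.Normed.MulAction
import Mathlib.Analysis.Normed.Group.Uniform
import Literature.Geometry.Lorentzian.Genericity
import HarnessLib

-- provenance: harness21/H21/H21/Prelude/Lorentz/SphericalEinsteinScalar.lean @ d20076f (interim HEAD d8f2665); M5 mechanical rewrite
/-!
# The spherically symmetric Einstein–scalar field model (trunk T-LORENTZ / G08, family `gr`)

Christodoulou's reduction of the Einstein equations coupled to a massless scalar field `φ` under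
spherical symmetry, in Bondi coordinates `(u, r)` on the quotient `Q = M / SO(3)`
(`u` a retarded time labelling the outgoing null cones, `r` the area radius). The metric is
`-g ḡ du² - 2 g du dr + r² dΩ²` and the whole system reduces to a single nonlinear transport
equation for `h := ∂_r (r φ)`:

* `h̄(u,r) := r⁻¹ ∫₀ʳ h(u,s) ds` (so that `φ = h̄`),
* `g(u,r) := exp (4π ∫₀ʳ (h - h̄)² ds/s)`, `ḡ(u,r) := r⁻¹ ∫₀ʳ g(u,s) ds`,
* `D := ∂_u - ½ ḡ ∂_r` (the derivative along the incoming null direction),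
* **the reduced equation** `D h = (2r)⁻¹ (g - ḡ) (h - h̄)`,
* Hawking mass `m = (r/2) (1 - ḡ/g)`.

Sources: D. Christodoulou, *The problem of a self-gravitating scalar field*, CMP **105** (1986)
337–361, §1, eqs. (1.11)–(1.13); *Global existence of generalized solutions …*, CMP **109**
(1987) 613–647; *The formation of black holes and singularities in spherically symmetric
gravitational collapse*, CPAM **44** (1991) 339–373, §1; *Bounded variation solutions of the
spherically symmetric Einstein-scalar field equations*, CPAM **46** (1993) 1131–1220, §1;
*Examples of naked singularity formation in the gravitational collapse of a scalar field*,
Ann. Math. **140** (1994) 607–653; *The instability of naked singularities in the gravitational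
collapse of a scalar field*, Ann. Math. **149** (1999) 183–217, §1 and Thm. p. 187.

## Main definitions (namespace `Literature.Lorentz.SphSym`)

* `hbar`, `gFn`, `gbar`, `massFn`, `transportOp`, `IsClassicalSolutionOn`: the real reduced
  system for `h : ℝ → ℝ → ℝ` (curried, `h u r`).
* `dataSpace : Submodule ℝ (ℝ → ℝ)`: initial data `α₀ = h(0, ·)` of bounded variation on the
  half-line `[0, ∞)` (the initial outgoing cone `C₀⁺`); `admissible : Set dataSpace` (data
  possessing a maximal development in the sense of this file).
* `BVDevelopment α₀`: hypothesis structure for a (bounded-variation) development of the datum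
  `α₀` in the Bondi chart; `BVDevelopment.IsMaximal`.
* `bondiTimeRange`, `bondiRate`, `bondiTime`, `HasCompleteNullInfinity`, `FormsBlackHole`,
  `HasNakedSingularity`, `nakedSingularityData` — the predicates consumed by gr.S20
  (`H21/Statements/GR/CosmicCensorship.lean`; the id is tagged there, not here).

## Mathlib

Mathlib has `BoundedVariationOn` / `LocallyBoundedVariationOn` / `eVariationOn`
(`Mathlib.Topology.EMetricSpace.BoundedVariation`), `intervalIntegral` (`∫ s in a..b`), set
integrals and `Real.exp`; it has no closure of `BoundedVariationOn` under addition or under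
scalar multiplication and no `boundedVariationOn_const` (proved below, in a preliminary section,
at Mathlib generality; `BoundedVariationOn.add` / `BoundedVariationOn.const_smul` deliberately
extend Mathlib's `BoundedVariationOn` namespace for dot notation), and nothing on the
Einstein–scalar field system (`rg -i "bondi|einstein.?scalar|christodoulou"` in Mathlib: no hits).

## Design choices and flags

* **Normalisation of `u`.** The integrating factor `g` is normalised at the *centre*,
  `g(u,0) = 1` (integral `∫₀ʳ` with a `+` sign), so that `u` is proper time of the central
  observer and every outgoing cone `{u = const}` in the chart starts at a centre point. This is
  exactly the system of CPAM 46 (1993) §1 (equations for `g`, `ḡ`, `m` and `D h`, coefficients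
  `4π`, `½`, `(2r)⁻¹` as written there). CMP 105 (1986) (1.12) instead normalises at infinity,
  `g = exp (-4π ∫ᵣ^∞ (h - h̄)² ds/s)`, making `u` the Bondi (proper) time at null infinity; the two
  differ by the `u`-dependent factor `bondiRate h u = exp (4π ∫₀^∞ (h - h̄)² ds/s)` and the reduced
  equation is invariant under the corresponding reparametrisation of `u`.
* Because `u` is central proper time, "Bondi time unbounded" must be measured with the
  conversion factor: `HasCompleteNullInfinity 𝒟` says that the Bondi time
  `∫ bondiRate du` accumulated over the retarded times whose cones reach infinity
  (`bondiTimeRange 𝒟`) is infinite. With the literal reading "`bondiTimeRange` unbounded" a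
  black-hole spacetime (centre singular after finite proper time, event horizon = last cone
  reaching infinity) would wrongly count as having incomplete `𝓘⁺`.
  `hasCompleteNullInfinity_of_not_bddAbove` records that the literal reading is sufficient.
* The Bondi chart `(u, r)` uses the area radius as a coordinate along outgoing cones and hence
  covers the non-trapped part of the quotient only (Christodoulou, CPAM 44 (1991) §1); the
  trapped region `𝒯` and the strictly spacelike singular boundary `𝓑` of CPAM 46 (1993) Thm. 1
  are not represented. This is enough for the predicates below (completeness of `𝓘⁺`, existence
  of an event horizon, regularity of the centre), which only look at the causal past of `𝓘⁺`.
* `IsClassicalSolutionOn Q h` is the *classical* notion (CMP 105 (1986): `h ∈ C⁰(Q) ∩ C¹(int Q)`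
  and the reduced equation on `interior Q`); Christodoulou's BV notion of solution (CPAM 46
  (1993) §1, the equation integrated along incoming characteristics) is replaced by it in v0 and
  the BV regularity is recorded separately in `BVDevelopment.boundedVariationOn` (finite total
  variation on each outgoing cone, as Christodoulou's BV solutions have). Flagged. NB: the
  classical notion **forces the datum to be continuous** on `[0, ∞)` (`h` is continuous on
  `Q ⊇ {0} × [0,∞)` and `h(0,·) = α₀`), so discontinuous BV data have *no* development in the
  present sense; this is why `admissible` below is not all of `dataSpace`.
* `dataSpace` uses `BoundedVariationOn α₀ (Set.Ici 0)` (finite total variation on the half-line,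
  the class "BV" of CPAM 46 (1993) and Ann. Math. 149 (1999)); it is a submodule, so
  `HasLinearCodimAtLeast` (families `α₀ + λ₁ f₁ + λ₂ f₂`) applies.
* **`admissible := {α₀ | ∃ 𝒟 : BVDevelopment α₀, 𝒟.IsMaximal}`** (data possessing a maximal
  development in the sense of this file) and `nakedSingularityData ⊆ admissible`
  (`nakedSingularityData_subset_admissible`). The `𝓓` slot of `HasLinearCodimAtLeast` then
  requires the perturbed data `α₀ + λ₁ f₁ + λ₂ f₂` to have maximal developments too, one of which
  must fail to have a naked singularity — the real content of Ann. Math. 149 Thm. p. 187 — and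
  rules out the vacuous "perturb by a step function, which has no classical development"
  argument that `admissible = univ` would allow. `zero_mem_admissible` (Minkowski) records
  `admissible ≠ ∅`. The absolutely continuous subclass `𝒜` of Ann. Math. 149 is not singled out
  in v0.
* Junk values (documented on each declaration): `hbar h u 0 := h u 0`, `gbar h u 0 := gFn h u 0
  (= 1)`, `nonlinearity h u 0 = 0`; non-integrable integrands give `0` by Mathlib's convention
  (`gFn = 1`, `bondiRate = 1`); values at `r < 0` are irrelevant.
* `BVDevelopment.IsMaximal` is a real definition (no proper extension among `BVDevelopment`s of
  the same datum), replacing the outline's bare `Prop` field. It is a *predicate on developments*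
  (the development is an explicit binder, so that it is not read as a closed named fact): some
  developments are maximal (`isMaximal_minkowskiDevelopment`) and some are not
  (`exists_not_isMaximal`, via the truncations `BVDevelopment.truncate`). Christodoulou's theorem
  that every BV datum has a unique maximal BV development (CPAM 46 (1993) Thm. 1) is **not**
  asserted in this file.
* `HasNakedSingularity` is, in this chart, *definitionally* just incompleteness of `𝓘⁺`
  (`hasNakedSingularity_iff`): the "regular centre up to the end" conjunct is automatic from the
  structure axiom `BVDevelopment.cone_mem`. This matches the use in gr.S20 (weak cosmic
  censorship in the model).
-/

open MeasureTheory Set Filter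
open scoped Topology ENNReal

noncomputable section

/-! ### Preliminaries on bounded variation (Mathlib gaps, stated at Mathlib generality) -/

section BV

variable {α : Type*} [LinearOrder α] {E : Type*} [SeminormedAddCommGroup E]

/-- Subadditivity of the total variation in a seminormed additive group:
`V(f + g) ≤ V(f) + V(g)` (termwise `edist_add_add_le`). Not in Mathlib at the pin. [folklore] -/
lemma Literature.Geometry.Lorentzian.eVariationOn_add_le (f g : α → E) (s : Set α) :
    eVariationOn (f + g) s ≤ eVariationOn f s + eVariationOn g s := by
  refine iSup_le fun p ↦ ?_
  calc ∑ i ∈ Finset.range p.1, edist ((f + g) (p.2.1 (i + 1))) ((f + g) (p.2.1 i))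
      ≤ ∑ i ∈ Finset.range p.1,
          (edist (f (p.2.1 (i + 1))) (f (p.2.1 i)) + edist (g (p.2.1 (i + 1))) (g (p.2.1 i))) :=
        Finset.sum_le_sum fun i _ ↦ edist_add_add_le _ _ _ _
    _ = (∑ i ∈ Finset.range p.1, edist (f (p.2.1 (i + 1))) (f (p.2.1 i))) +
          ∑ i ∈ Finset.range p.1, edist (g (p.2.1 (i + 1))) (g (p.2.1 i)) :=
        Finset.sum_add_distrib
    _ ≤ eVariationOn f s + eVariationOn g s :=
        add_le_add (eVariationOn.sum_le p.2.2.1 p.2.2.2) (eVariationOn.sum_le p.2.2.1 p.2.2.2)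

/-- Bounded variation is preserved under addition (seminormed additive group). Deliberate
dot-notation extension of Mathlib's `BoundedVariationOn` namespace (not in Mathlib at the pin).
[folklore] -/
lemma BoundedVariationOn.add {f g : α → E} {s : Set α} (hf : BoundedVariationOn f s)
    (hg : BoundedVariationOn g s) : BoundedVariationOn (f + g) s :=
  ne_top_of_le_ne_top (ENNReal.add_ne_top.2 ⟨hf, hg⟩) (Literature.Geometry.Lorentzian.eVariationOn_add_le f g s)

/-- Bounded variation is preserved under scalar multiplication by a bounded scalar action
(`LipschitzWith.comp_boundedVariationOn` for `x ↦ c • x`, `lipschitzWith_smul`). Deliberate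
dot-notation extension of Mathlib's `BoundedVariationOn` namespace (not in Mathlib at the pin).
[folklore] -/
lemma BoundedVariationOn.const_smul {𝕜 : Type*} [SeminormedAddGroup 𝕜] [SMulZeroClass 𝕜 E]
    [IsBoundedSMul 𝕜 E] {f : α → E} {s : Set α} (c : 𝕜) (hf : BoundedVariationOn f s) :
    BoundedVariationOn (c • f) s :=
  (lipschitzWith_smul c).comp_boundedVariationOn hf

/-- Constant functions have bounded variation (variation `0`, `eVariationOn.constant_on`), in
any pseudo-emetric codomain. Not in Mathlib at the pin. [folklore] -/
lemma Literature.Geometry.Lorentzian.boundedVariationOn_const {F : Type*} [PseudoEMetricSpace F] (c : F) (s : Set α) :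
    BoundedVariationOn (fun _ : α ↦ c) s := by
  rw [BoundedVariationOn, eVariationOn.constant_on]
  · exact ENNReal.zero_ne_top
  · rintro _ ⟨_, _, rfl⟩ _ ⟨_, _, rfl⟩
    rfl

end BV

namespace Literature.Geometry.Lorentzian.SphSym

/-! ### The reduced system -/

/-- The closed quarter plane `[0,∞) ×ˢ [0,∞) = {(u, r) | 0 ≤ u, 0 ≤ r}` in which the Bondi chart
of the quotient `Q = M/SO(3)` takes values (`u ≥ 0`: future of the initial cone `C₀⁺ = {u = 0}`;
`r ≥ 0`: area radius, `r = 0` the centre `Γ`). Christodoulou, CPAM 46 (1993) §1. [folklore] -/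
def quarterPlane : Set (ℝ × ℝ) := Ici 0 ×ˢ Ici 0

/-- Membership in the quarter plane. [folklore] -/
@[simp] lemma mem_quarterPlane {p : ℝ × ℝ} : p ∈ quarterPlane ↔ 0 ≤ p.1 ∧ 0 ≤ p.2 :=
  mem_prod

section ReducedSystem

variable (h : ℝ → ℝ → ℝ)

/-- The radial average `h̄(u,r) := r⁻¹ ∫₀ʳ h(u,s) ds` of `h = ∂_r(rφ)`; it equals the scalar
field `φ` itself. Junk value at the centre: `h̄(u,0) := h(u,0)` (the limit value for continuous
`h`). Christodoulou, CMP 105 (1986) (1.11); CPAM 44 (1991) §1. [folklore] -/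
def hbar (u r : ℝ) : ℝ := if r = 0 then h u 0 else r⁻¹ * ∫ s in 0..r, h u s

/-- The metric function `g(u,r) := exp (4π ∫₀ʳ (h - h̄)²(u,s) ds/s)` (so `g(u,0) = 1`: `u` is
proper time at the centre; see the module docstring for the normalisation at infinity used in
CMP 105 (1986) (1.12), which differs by the factor `bondiRate h u`). If the integrand is not
integrable the integral is `0` by Mathlib's convention (junk `g = 1`). Christodoulou, CMP 105
(1986) (1.12); CPAM 44 (1991) §1. [folklore] -/
def gFn (u r : ℝ) : ℝ := Real.exp (4 * Real.pi * ∫ s in 0..r, (h u s - hbar h u s) ^ 2 / s)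

/-- The radial average `ḡ(u,r) := r⁻¹ ∫₀ʳ g(u,s) ds` of `g`; the quotient metric is
`-g ḡ du² - 2 g du dr`. Junk value at the centre: `ḡ(u,0) := g(u,0)`. Christodoulou, CMP 105
(1986) (1.12); CPAM 44 (1991) §1. [folklore] -/
def gbar (u r : ℝ) : ℝ := if r = 0 then gFn h u 0 else r⁻¹ * ∫ s in 0..r, gFn h u s

/-- The (Hawking) mass function `m(u,r) := (r/2) (1 - ḡ/g)` of the reduced system
(`1 - 2m/r = ḡ/g`). Christodoulou, CPAM 44 (1991) §1; CPAM 46 (1993) §1. [folklore] -/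
def massFn (u r : ℝ) : ℝ := r / 2 * (1 - gbar h u r / gFn h u r)

/-- The transport operator `D h := ∂_u h - ½ ḡ ∂_r h`, the derivative of `h` along the incoming
null direction `∂_u - ½ ḡ ∂_r` of the quotient metric `-g ḡ du² - 2 g du dr`, written with
one-variable derivatives (`deriv`; meaningful at interior points where `h` is differentiable).
Christodoulou, CMP 105 (1986) (1.13); CPAM 44 (1991) §1. [folklore] -/
def transportOp (u r : ℝ) : ℝ :=
  deriv (fun u' ↦ h u' r) u - 1 / 2 * gbar h u r * deriv (fun r' ↦ h u r') r

/-- The right-hand side `(2r)⁻¹ (g - ḡ) (h - h̄)` of the reduced Einstein–scalar field equation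
`D h = (2r)⁻¹ (g - ḡ)(h - h̄)`. Junk value at the centre: `(2·0)⁻¹ = 0` by Mathlib's convention,
so `nonlinearity h u 0 = 0`; only interior points `r > 0` are ever used
(`IsClassicalSolutionOn`). Christodoulou, CMP 105 (1986) (1.13); CPAM 46 (1993) §1. [folklore] -/
def nonlinearity (u r : ℝ) : ℝ :=
  (2 * r)⁻¹ * (gFn h u r - gbar h u r) * (h u r - hbar h u r)

/-- `h` is a **classical solution of the reduced spherically symmetric Einstein–scalar field
system on `Q ⊆ ℝ²`**: `h` is continuous on `Q`, differentiable on the interior of `Q`, and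
satisfies `D h = (2r)⁻¹ (g - ḡ)(h - h̄)` at every interior point (Christodoulou's `C¹` solutions
of CMP 105 (1986) §1, eqs. (1.11)–(1.13); the BV notion of CPAM 46 (1993) §1 is *not* rendered
in v0, see the module docstring). [folklore] -/
def IsClassicalSolutionOn (Q : Set (ℝ × ℝ)) (h : ℝ → ℝ → ℝ) : Prop :=
  ContinuousOn (Function.uncurry h) Q ∧ DifferentiableOn ℝ (Function.uncurry h) (interior Q) ∧
    ∀ p ∈ interior Q, transportOp h p.1 p.2 = nonlinearity h p.1 p.2

/-- The conversion factor from central proper time `u` to Bondi time at null infinity: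
`bondiRate h u := lim_{r → ∞} g(u,r) = exp (4π ∫₀^∞ (h - h̄)² ds/s)` (proper time of observers
at large `r` elapses at rate `√(g ḡ) → g(u,∞)` per unit `u`). For `h(u,·)` of bounded variation
on `[0,∞)` the integral converges (Hardy-type bound by the total variation; this is why
`BVDevelopment.boundedVariationOn` records *finite* total variation on each cone); if the
integrand is not integrable, Mathlib's junk value `0` of the integral gives `bondiRate = 1`
(documented junk). Christodoulou, CMP 105 (1986) (1.12) (normalisation `g → 1` at infinity);
CPAM 44 (1991) §1. [folklore] -/
def bondiRate (u : ℝ) : ℝ :=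
  Real.exp (4 * Real.pi * ∫ s in Ioi (0 : ℝ), (h u s - hbar h u s) ^ 2 / s)

/-- Bondi (retarded proper) time at null infinity of the outgoing cone labelled by central
proper time `u`: `∫₀ᵘ bondiRate h u' du'`. Christodoulou, CMP 105 (1986) §1; Ann. Math. 149
(1999) §1. [folklore] -/
def bondiTime (u : ℝ) : ℝ := ∫ u' in 0..u, bondiRate h u'

section API

/-- For the trivial field `h = 0` (Minkowski space) the average `h̄` vanishes. [folklore] -/
@[simp] lemma hbar_zero (u r : ℝ) : hbar 0 u r = 0 := by
  simp [hbar]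

/-- For the trivial field `h = 0` (Minkowski space), `g ≡ 1`. [folklore] -/
@[simp] lemma gFn_zero (u r : ℝ) : gFn 0 u r = 1 := by
  simp [gFn]

/-- For the trivial field `h = 0` (Minkowski space), `ḡ ≡ 1`. [folklore] -/
@[simp] lemma gbar_zero (u r : ℝ) : gbar 0 u r = 1 := by
  unfold gbar
  split_ifs with hr
  · simp
  · simp [hr]

/-- For the trivial field the mass function vanishes (Minkowski space has zero Hawking mass). [folklore] -/
@[simp] lemma massFn_zero (u r : ℝ) : massFn 0 u r = 0 := by
  simp [massFn]

/-- At the centre `g(u,0) = 1`: `u` is normalised to be central proper time. [folklore] -/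
@[simp] lemma gFn_zero_right (u : ℝ) : gFn h u 0 = 1 := by
  simp [gFn]

/-- The Bondi rate is at least `1` (Bondi time runs at least as fast as central proper time),
since the exponent `4π ∫₀^∞ (h - h̄)²/s ds` is nonnegative. [folklore] -/
lemma one_le_bondiRate (u : ℝ) : 1 ≤ bondiRate h u := by
  refine Real.one_le_exp (mul_nonneg (by positivity) (setIntegral_nonneg measurableSet_Ioi ?_))
  intro s hs
  exact div_nonneg (sq_nonneg _) (le_of_lt hs)

/-- The trivial field `h = 0` is a classical solution on every domain (Minkowski space in Bondi
coordinates `u = t - r`). [folklore] -/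
lemma isClassicalSolutionOn_zero (Q : Set (ℝ × ℝ)) : IsClassicalSolutionOn Q 0 := by
  refine ⟨continuousOn_const, differentiableOn_const 0, fun p _ ↦ ?_⟩
  simp [transportOp, nonlinearity]

end API

end ReducedSystem

/-! ### Data and developments -/

/-- **The space of initial data** for the spherically symmetric Einstein–scalar field:
functions `α₀ : ℝ → ℝ` (the restriction of `h = ∂_r(rφ)` to the initial future cone `C₀⁺`,
parametrised by the area radius `r ∈ [0,∞)`) of bounded variation on the half-line
`Set.Ici 0` (values at `r < 0` are irrelevant). It is a real vector subspace of `ℝ → ℝ`, so that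
Christodoulou's affine families `α₀ + λ₁ f₁ + λ₂ f₂` make sense (`HasLinearCodimAtLeast`).
Christodoulou, CPAM 46 (1993) §1 ("BV"); Ann. Math. 149 (1999) §1. [folklore] -/
def dataSpace : Submodule ℝ (ℝ → ℝ) where
  carrier := {α₀ | BoundedVariationOn α₀ (Ici 0)}
  add_mem' hf hg := hf.add hg
  zero_mem' := Literature.Geometry.Lorentzian.boundedVariationOn_const (0 : ℝ) _
  smul_mem' c _ hf := hf.const_smul c

/-- Membership in `dataSpace` is bounded variation on `[0, ∞)`. [folklore] -/
lemma mem_dataSpace {α₀ : ℝ → ℝ} : α₀ ∈ dataSpace ↔ BoundedVariationOn α₀ (Ici 0) := Iff.rfl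

/-- **A bounded-variation development** of the datum `α₀` (hypothesis structure): a region `Q`
of the closed quarter plane in Bondi coordinates `(u, r)` (relatively open, containing the
initial cone `{0} × [0,∞)`, closed under passing to the past along the timelike lines
`{r = const}` and along the outgoing cones towards the centre), together with a classical
solution `h` of the reduced system on `Q` taking the datum on the initial cone and of bounded
variation on each outgoing cone. This renders "a BV development of BV data" of
Christodoulou, CPAM 46 (1993) §1 and Thm. 1 (existence and structure of the maximal BV
development), in the (non-trapped part of the) Bondi chart; see the module docstring for what
is not represented. Since `IsClassicalSolutionOn` asks continuity on `Q ⊇ {0} × [0,∞)`, a datum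
admitting a development is necessarily continuous on `[0,∞)`. [folklore] -/
structure BVDevelopment (α₀ : dataSpace) where
  /-- The domain of the development in the Bondi chart `(u, r)`. -/
  Q : Set (ℝ × ℝ)
  /-- The unknown `h = ∂_r (r φ)` as a curried function `h u r` (values off `Q` irrelevant). -/
  h : ℝ → ℝ → ℝ
  /-- `Q` lies in the closed quarter plane `{0 ≤ u, 0 ≤ r}`. -/
  subset_quarterPlane : Q ⊆ quarterPlane
  /-- `Q` is relatively open in the quarter plane. -/
  exists_isOpen : ∃ U : Set (ℝ × ℝ), IsOpen U ∧ Q = U ∩ quarterPlane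
  /-- `Q` contains the initial cone `C₀⁺ = {u = 0, r ≥ 0}`. -/
  initialCone_mem : ∀ r : ℝ, 0 ≤ r → ((0 : ℝ), r) ∈ Q
  /-- `Q` is past-closed along the timelike lines `r = const`. -/
  past_mem : ∀ p ∈ Q, ∀ u ∈ Icc 0 p.1, (u, p.2) ∈ Q
  /-- `Q` contains, with a point, the segment of its outgoing cone down to the centre. -/
  cone_mem : ∀ p ∈ Q, ∀ r ∈ Icc 0 p.2, (p.1, r) ∈ Q
  /-- `h` is a classical solution of the reduced system on `Q`. -/
  isSolution : IsClassicalSolutionOn Q h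
  /-- `h` takes the datum `α₀` on the initial cone. -/
  initial : ∀ r : ℝ, 0 ≤ r → h 0 r = (α₀ : ℝ → ℝ) r
  /-- BV regularity: `h(u, ·)` has bounded (finite total) variation on each outgoing cone in
  `Q` (Christodoulou's BV solutions, CPAM 46 (1993) §1). -/
  boundedVariationOn : ∀ u : ℝ, BoundedVariationOn (h u) {r | (u, r) ∈ Q}

namespace BVDevelopment

variable {α₀ : dataSpace} (𝒟 : BVDevelopment α₀)

/-- A development `𝒟'` **extends** `𝒟` if its domain contains that of `𝒟` and the solutions
agree on the smaller domain. Christodoulou, CPAM 46 (1993) §1. [folklore] -/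
def IsExtension (𝒟' : BVDevelopment α₀) : Prop :=
  𝒟.Q ⊆ 𝒟'.Q ∧ ∀ p ∈ 𝒟.Q, 𝒟'.h p.1 p.2 = 𝒟.h p.1 p.2

/-- `𝒟` is a **maximal development** of its datum: every development extending it has the same
domain (the notion of maximality of Christodoulou's maximal BV development, CPAM 46 (1993)
Thm. 1; Ann. Math. 149 (1999) §1). This is a *predicate* on developments — the development `𝒟`
is an explicit argument and the definition asserts nothing by itself: `exists_not_isMaximal`
exhibits a non-maximal development, `isMaximal_minkowskiDevelopment` a maximal one, and the
existence of a maximal development for every BV datum (CPAM 46 (1993) Thm. 1) is not stated in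
this file. [folklore] -/
def IsMaximal (𝒟 : BVDevelopment α₀) : Prop :=
  ∀ 𝒟' : BVDevelopment α₀, 𝒟.IsExtension 𝒟' → 𝒟'.Q = 𝒟.Q

/-- Every development extends itself. [folklore] -/
lemma isExtension_refl : 𝒟.IsExtension 𝒟 := ⟨Subset.rfl, fun _ _ ↦ rfl⟩

/-- The initial cone lies in every development: `(0, r) ∈ Q` for `r ≥ 0`. [folklore] -/
lemma zero_mem_of_nonneg {r : ℝ} (hr : 0 ≤ r) : ((0 : ℝ), r) ∈ 𝒟.Q := 𝒟.initialCone_mem r hr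

/-- A development whose domain is the whole closed quarter plane is maximal (every development
lives inside the quarter plane). [folklore] -/
lemma isMaximal_of_Q_eq_quarterPlane (hQ : 𝒟.Q = quarterPlane) : 𝒟.IsMaximal := fun 𝒟' h ↦
  Subset.antisymm (fun _ hp ↦ hQ ▸ 𝒟'.subset_quarterPlane hp) h.1

/-- **Truncation of a development at a retarded time `T > 0`**: the part `Q ∩ {u < T}` of its
domain, with the same solution `h`. It is again a development of the same datum (all structure
axioms restrict: `{u < T}` is open, contains the initial cone `u = 0`, and is past-closed), and
`𝒟` extends it (`isExtension_truncate`); truncations omitting a point of `Q` are the basic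
examples of non-maximal developments (`not_isMaximal_truncate`). [folklore] -/
def truncate (T : ℝ) (hT : 0 < T) : BVDevelopment α₀ where
  Q := 𝒟.Q ∩ {p | p.1 < T}
  h := 𝒟.h
  subset_quarterPlane := inter_subset_left.trans 𝒟.subset_quarterPlane
  exists_isOpen := by
    obtain ⟨U, hU, hQ⟩ := 𝒟.exists_isOpen
    exact ⟨U ∩ {p | p.1 < T}, hU.inter (isOpen_lt continuous_fst continuous_const),
      by rw [hQ, inter_right_comm]⟩
  initialCone_mem r hr := ⟨𝒟.initialCone_mem r hr, hT⟩
  past_mem p hp u hu := ⟨𝒟.past_mem p hp.1 u hu, hu.2.trans_lt hp.2⟩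
  cone_mem p hp r hr := ⟨𝒟.cone_mem p hp.1 r hr, hp.2⟩
  isSolution := ⟨𝒟.isSolution.1.mono inter_subset_left,
    𝒟.isSolution.2.1.mono (interior_mono inter_subset_left),
    fun p hp ↦ 𝒟.isSolution.2.2 p (interior_mono inter_subset_left hp)⟩
  initial := 𝒟.initial
  boundedVariationOn u := (𝒟.boundedVariationOn u).mono fun _ hr ↦ hr.1

/-- The domain of the truncation at `T` is `Q ∩ {u < T}`. [folklore] -/
@[simp] lemma truncate_Q (T : ℝ) (hT : 0 < T) : (𝒟.truncate T hT).Q = 𝒟.Q ∩ {p | p.1 < T} := rfl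

/-- The truncation has the same solution `h`. [folklore] -/
@[simp] lemma truncate_h (T : ℝ) (hT : 0 < T) : (𝒟.truncate T hT).h = 𝒟.h := rfl

/-- A development extends each of its truncations. [folklore] -/
lemma isExtension_truncate (T : ℝ) (hT : 0 < T) : (𝒟.truncate T hT).IsExtension 𝒟 :=
  ⟨inter_subset_left, fun _ _ ↦ rfl⟩

/-- A truncation at `T` that omits a point of `Q` (some `p ∈ Q` with `T ≤ u(p)`) is **not**
maximal: `𝒟` is a proper extension. [folklore] -/
lemma not_isMaximal_truncate {T : ℝ} (hT : 0 < T) {p : ℝ × ℝ} (hp : p ∈ 𝒟.Q) (hTp : T ≤ p.1) :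
    ¬ (𝒟.truncate T hT).IsMaximal := fun hmax ↦ by
  have hp' : p ∈ (𝒟.truncate T hT).Q := hmax 𝒟 (𝒟.isExtension_truncate T hT) ▸ hp
  exact (not_lt.2 hTp) hp'.2

end BVDevelopment

/-- **The admissible class of data** inside which genericity is measured: BV data possessing a
maximal development in the sense of this file (`BVDevelopment`, `BVDevelopment.IsMaximal`).
For Christodoulou every BV datum has a unique maximal BV development (CPAM 46 (1993) Thm. 1),
so informally this is the whole BV class in which the instability theorem (Ann. Math. 149
(1999) Thm. p. 187) is stated; formally, with the classical solution notion of v0, it excludes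
in particular all discontinuous data (module docstring), and — crucially — it makes the `𝓓` slot
of `HasLinearCodimAtLeast` demand that perturbed data have maximal developments.
`zero_mem_admissible` shows it is nonempty. The AC subclass `𝒜` is not singled out in v0. [folklore] -/
def admissible : Set dataSpace := {α₀ | ∃ 𝒟 : BVDevelopment α₀, 𝒟.IsMaximal}

/-- Membership in `admissible` is existence of a maximal development. [folklore] -/
lemma mem_admissible {α₀ : dataSpace} :
    α₀ ∈ admissible ↔ ∃ 𝒟 : BVDevelopment α₀, 𝒟.IsMaximal := Iff.rfl

/-! ### Null infinity, black holes and naked singularities in the model -/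

variable {α₀ : dataSpace}

/-- The **range of retarded times whose outgoing cones reach null infinity**:
`{u | the cone {u} × [0,∞) meets Q at arbitrarily large r}` — the retarded times of the causal
past of `𝓘⁺` (domain of outer communications) in the Bondi chart. Christodoulou, CPAM 44 (1991)
§1; Ann. Math. 149 (1999) §1. [folklore] -/
def bondiTimeRange (𝒟 : BVDevelopment α₀) : Set ℝ :=
  {u | ∀ R : ℝ, ∃ r, R < r ∧ (u, r) ∈ 𝒟.Q}

/-- The development **has complete future null infinity**: the total Bondi time elapsed at
infinity, `∫_{bondiTimeRange 𝒟} bondiRate du` (an extended-nonnegative Lebesgue integral, no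
integrability junk), is infinite. Since `bondiRate ≥ 1`, this holds whenever `bondiTimeRange 𝒟`
is unbounded (`hasCompleteNullInfinity_of_not_bddAbove`); when the range is bounded (an event
horizon forms at finite central proper time) it asks that Bondi time nevertheless diverges on
approach to the horizon. This is Christodoulou's completeness of `𝓘⁺` in the model (CQG 16
(1999) A23; Ann. Math. 149 (1999) §1: "future null infinity is complete, `u → ∞`"), consistent
in spirit with the sojourn form `HasCompleteFutureNullInfinity` of the general theory. [folklore] -/
def HasCompleteNullInfinity (𝒟 : BVDevelopment α₀) : Prop :=
  ∫⁻ u in bondiTimeRange 𝒟, ENNReal.ofReal (bondiRate 𝒟.h u) = ∞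

/-- The development **forms a black hole**: null infinity is complete and there is an event
horizon, i.e. some outgoing cone of `Q` does not reach infinity (its retarded time is not in
`bondiTimeRange`). Christodoulou, CPAM 44 (1991) Thm. 1; Ann. Math. 149 (1999) Thm. p. 187
(conclusion "a black hole forms"). The trapped region itself is not visible in the Bondi chart
(module docstring). [folklore] -/
def FormsBlackHole (𝒟 : BVDevelopment α₀) : Prop :=
  HasCompleteNullInfinity 𝒟 ∧ ∃ p ∈ 𝒟.Q, p.1 ∉ bondiTimeRange 𝒟

/-- The development has a **regular centre up to the end** (as seen from infinity): every
outgoing cone reaching null infinity emanates from a regular centre point of the development,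
`(u, 0) ∈ Q` for all `u ∈ bondiTimeRange` (Christodoulou, Ann. Math. 140 (1994) §1: the centre
`Γ` is regular up to the first singular point `e`, whose future light cone bounds the
development). With the structure axiom `BVDevelopment.cone_mem` this is automatic
(`hasRegularCentre`); it is kept as a named conjunct for fidelity. [folklore] -/
def HasRegularCentre (𝒟 : BVDevelopment α₀) : Prop :=
  ∀ u ∈ bondiTimeRange 𝒟, (u, (0 : ℝ)) ∈ 𝒟.Q

/-- The development **has a naked singularity**: future null infinity is incomplete while the
centre is regular up to the end (the singular centre point is visible from infinity: its future
light cone is the future boundary of the development and cuts off `𝓘⁺` at finite Bondi time).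
In the Bondi chart the regular-centre conjunct is automatic (`hasRegularCentre`), so this is
definitionally equivalent to `¬ HasCompleteNullInfinity 𝒟` (`hasNakedSingularity_iff`); the
conjunct is kept for fidelity to the informal definition. Christodoulou, Ann. Math. 140 (1994)
§1 (definition and examples); Ann. Math. 149 (1999) §1. [folklore] -/
def HasNakedSingularity (𝒟 : BVDevelopment α₀) : Prop :=
  ¬ HasCompleteNullInfinity 𝒟 ∧ HasRegularCentre 𝒟

/-- **The exceptional set `𝓔` of naked-singularity data**: admissible BV data (i.e. admitting a
maximal development, `admissible`) all of whose maximal developments have a naked singularity.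
Christodoulou's instability theorem (Ann. Math. 149 (1999) Thm. p. 187) says `𝓔` has positive
(indeed `2`) linear codimension inside the admissible class; this feeds gr.S20's
`HasLinearCodimAtLeast admissible nakedSingularityData 1` in
`H21/Statements/GR/CosmicCensorship.lean` (perturbed data must lie in `admissible`, hence have
maximal developments, one of which has complete `𝓘⁺`), and Ann. Math. 140 (1994) shows
`𝓔 ≠ ∅`. See `nakedSingularityData_subset_admissible`. [folklore] -/
def nakedSingularityData : Set dataSpace :=
  {α₀ | α₀ ∈ admissible ∧ ∀ 𝒟 : BVDevelopment α₀, 𝒟.IsMaximal → HasNakedSingularity 𝒟}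

/-- The exceptional set lies inside the admissible class. [folklore] -/
lemma nakedSingularityData_subset_admissible : nakedSingularityData ⊆ admissible :=
  fun _ hα ↦ hα.1

section API

variable (𝒟 : BVDevelopment α₀)

/-- The initial retarded time `0` lies in the Bondi time range (the initial cone is complete).
[folklore] -/
lemma zero_mem_bondiTimeRange : (0 : ℝ) ∈ bondiTimeRange 𝒟 := fun R ↦
  ⟨max R 0 + 1, (le_max_left R 0).trans_lt (lt_add_one _), 𝒟.initialCone_mem _ (by positivity)⟩

/-- The Bondi time range is an initial segment of `[0, ∞)`: past-closedness of `Q` along the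
lines `r = const` (`BVDevelopment.past_mem`). [folklore] -/
lemma mem_bondiTimeRange_of_le {u u' : ℝ} (hu : u ∈ bondiTimeRange 𝒟) (h0 : 0 ≤ u')
    (hle : u' ≤ u) : u' ∈ bondiTimeRange 𝒟 := fun R ↦ by
  obtain ⟨r, hRr, hmem⟩ := hu R
  exact ⟨r, hRr, 𝒟.past_mem (u, r) hmem u' ⟨h0, hle⟩⟩

/-- The Bondi time range consists of nonnegative retarded times. [folklore] -/
lemma nonneg_of_mem_bondiTimeRange {u : ℝ} (hu : u ∈ bondiTimeRange 𝒟) : 0 ≤ u := by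
  obtain ⟨r, -, hmem⟩ := hu 0
  exact (𝒟.subset_quarterPlane hmem).1

/-- Every development has a regular centre up to the end in the sense of `HasRegularCentre`
(from `BVDevelopment.cone_mem`). [folklore] -/
lemma hasRegularCentre : HasRegularCentre 𝒟 := fun u hu ↦ by
  obtain ⟨r, hr, hmem⟩ := hu 0
  exact 𝒟.cone_mem (u, r) hmem 0 ⟨le_rfl, hr.le⟩

/-- If the retarded times of cones reaching infinity are unbounded then null infinity is
complete (`bondiRate ≥ 1` and `bondiTimeRange ⊇ [0, ∞)` has infinite Lebesgue measure). This is
the literal reading "Bondi retarded time unbounded" of the outline. [folklore] -/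
lemma hasCompleteNullInfinity_of_not_bddAbove (hT : ¬ BddAbove (bondiTimeRange 𝒟)) :
    HasCompleteNullInfinity 𝒟 := by
  have hT : Ici (0 : ℝ) ⊆ bondiTimeRange 𝒟 := fun u' hu' ↦ by
    obtain ⟨u, hu, hlt⟩ := not_bddAbove_iff.1 hT u'
    exact mem_bondiTimeRange_of_le 𝒟 hu hu' hlt.le
  have h1 : ∫⁻ _ in Ici (0 : ℝ), (1 : ℝ≥0∞) ≤
      ∫⁻ u in bondiTimeRange 𝒟, ENNReal.ofReal (bondiRate 𝒟.h u) :=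
    lintegral_mono' (Measure.restrict_mono hT le_rfl) fun u ↦
      ENNReal.one_le_ofReal.2 (one_le_bondiRate _ u)
  rw [setLIntegral_one, Real.volume_Ici, top_le_iff] at h1
  exact h1

/-- A black hole is not a naked singularity. [folklore] -/
lemma not_hasNakedSingularity_of_formsBlackHole (hB : FormsBlackHole 𝒟) :
    ¬ HasNakedSingularity 𝒟 := fun h' ↦ h'.1 hB.1

/-- In the model, a naked singularity is exactly incompleteness of null infinity (the
regular-centre conjunct being automatic in the Bondi chart). [folklore] -/
lemma hasNakedSingularity_iff : HasNakedSingularity 𝒟 ↔ ¬ HasCompleteNullInfinity 𝒟 :=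
  ⟨fun hN ↦ hN.1, fun hN ↦ ⟨hN, hasRegularCentre 𝒟⟩⟩

end API

/-- **Minkowski development** of the zero datum: the whole quarter plane with `h = 0`. Sanity
example for the hypothesis structure. [folklore] -/
def minkowskiDevelopment : BVDevelopment 0 where
  Q := quarterPlane
  h := 0
  subset_quarterPlane := Subset.rfl
  exists_isOpen := ⟨univ, isOpen_univ, (univ_inter _).symm⟩
  initialCone_mem _ hr := mem_quarterPlane.2 ⟨le_rfl, hr⟩
  past_mem _ hp _ hu := mem_quarterPlane.2 ⟨hu.1, (mem_quarterPlane.1 hp).2⟩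
  cone_mem _ hp _ hr := mem_quarterPlane.2 ⟨(mem_quarterPlane.1 hp).1, hr.1⟩
  isSolution := isClassicalSolutionOn_zero _
  initial _ _ := rfl
  boundedVariationOn _ := Literature.Geometry.Lorentzian.boundedVariationOn_const (0 : ℝ) _

/-- The Bondi time range of the Minkowski development is all of `[0, ∞)`. [folklore] -/
lemma bondiTimeRange_minkowskiDevelopment : bondiTimeRange minkowskiDevelopment = Ici 0 := by
  ext u
  refine ⟨fun hu ↦ nonneg_of_mem_bondiTimeRange _ hu, fun hu R ↦ ?_⟩
  exact ⟨max R 0 + 1, (le_max_left R 0).trans_lt (lt_add_one _),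
    mem_quarterPlane.2 ⟨hu, by positivity⟩⟩

/-- Minkowski space has complete null infinity in the model (sanity check of the sign
conventions: `bondiTimeRange = [0, ∞)` is unbounded). [folklore] -/
lemma hasCompleteNullInfinity_minkowskiDevelopment :
    HasCompleteNullInfinity minkowskiDevelopment := by
  refine hasCompleteNullInfinity_of_not_bddAbove _ ?_
  simpa only [bondiTimeRange_minkowskiDevelopment] using not_bddAbove_Ici (a := (0 : ℝ))

/-- The Minkowski development is maximal (its domain is the whole quarter plane). [folklore] -/
lemma isMaximal_minkowskiDevelopment : minkowskiDevelopment.IsMaximal :=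
  fun 𝒟' h ↦ Subset.antisymm 𝒟'.subset_quarterPlane h.1

/-- **Not every development is maximal**: the Minkowski development truncated at `u < 1` omits
the point `(1, 0)` of the quarter plane and is properly extended by the Minkowski development.
Together with `isMaximal_minkowskiDevelopment` this records that `BVDevelopment.IsMaximal` is a
genuine predicate on developments, neither identically true nor identically false (so it has
no closed `_holds` form). [folklore] -/
lemma exists_not_isMaximal : ∃ 𝒟 : BVDevelopment (0 : dataSpace), ¬ 𝒟.IsMaximal :=
  ⟨minkowskiDevelopment.truncate 1 one_pos, minkowskiDevelopment.not_isMaximal_truncate one_pos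
    (p := (1, 0)) (mem_quarterPlane.2 ⟨zero_le_one, le_rfl⟩) le_rfl⟩

/-- The zero datum is admissible (the Minkowski development is maximal); in particular
`admissible` is nonempty. [folklore] -/
lemma zero_mem_admissible : (0 : dataSpace) ∈ admissible :=
  ⟨minkowskiDevelopment, isMaximal_minkowskiDevelopment⟩

/-- The zero datum (Minkowski space) is not naked-singularity data. [folklore] -/
lemma zero_notMem_nakedSingularityData : (0 : dataSpace) ∉ nakedSingularityData := fun h0 ↦
  (h0.2 minkowskiDevelopment isMaximal_minkowskiDevelopment).1
    hasCompleteNullInfinity_minkowskiDevelopment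

end Literature.Geometry.Lorentzian.SphSym

end
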